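import Literature.Analysis.FluidPDE.NSSuitableESSProofs
import Literature.Analysis.FluidPDE.NSEssSupBound
import Literature.Analysis.FluidPDE.NSSerrinUniqueness
import HarnessLib

/-!
# The endpoint criterion `NS.ess_endpoint`: assembly without the all-data weak–strong uniqueness

Analysis/FluidPDE proof file in the decomposition of **ns.S08** `Literature.Analysis.FluidPDE.ess_endpoint`
(Escauriaza–Seregin–Šverák 2003, Thm. 1.3). The accepted assemblies
(`NS.ess_endpoint_of_L5`, `NS.ess_L5_integrability_of`, `NS.ess_endpoint_of_sup_bound`,
`NS.ess_endpoint_of_local_regularity'`) consume the named fact `NS.weak_strong_uniqueness`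
(**ns.S07**), which quantifies over *all* data `u₀ : ℝ³ → ℝ³`; its printed form (datum in `L²`)
is the theorem `NS.serrin_weak_strong_uniqueness_holds` of `FluidPDE/NSSerrinUniqueness`, and
the remaining data are not treated in the sources. For solutions in `L^∞(0,T; L³)` that gap is
empty: by `Fluid.IsLerayHopfOn.aestronglyMeasurable_datum_or` either the datum is a.e. strongly
measurable (then square integrable, and the printed theorem applies), or every pairing
`∫ ⟪u₀, w⟫`, `w ∈ L²`, vanishes — and then `u ≡ 0` slice-wise a.e. by the energy equality for
`L⁴(Q_T)` very weak solutions (`NS.ae_slice_eq_zero_of_datum_zero`, from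
`NS.galdi_energy_equality`), so the strong attainment of the datum, `‖u(t) - u₀‖₂ → 0`, forces
`‖u₀‖₂ = 0`, i.e. `E(u₀) = 0`, and the energy inequality from `0` kills *every* Leray–Hopf
solution with that datum. Hence the uniqueness half of `NS.ess_endpoint` needs only the proved
theorem, and the assemblies are re-threaded accordingly:

* `NS.ess_unique_of_memLqLp_five` — uniqueness among Leray–Hopf solutions for
  `u ∈ L^∞_t L³_x ∩ L⁵_t L⁵_x` (ESS 2003, §3: "hence smooth and unique"), from
  `NS.galdi_energy_equality` only;
* `NS.ess_endpoint_of_L5_of_galdi : ess_L5_integrability → ladyzhenskaya_prodi_serrin →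
  galdi_energy_equality → ess_endpoint`;
* `NS.ess_L5_integrability_of_sup_bound : ess_sup_bound → ess_kato_L3_local →
  galdi_energy_equality → ess_L5_integrability`;
* `NS.ess_endpoint_of_ESS_theory` — `NS.ess_endpoint` from the six named facts
  `ess_local_holder` (ESS Thm. 1.4), `ess_epsilon_regularity'` (Lemma 2.2),
  `ess_associated_pressure` ((3.2)–(3.4)), `ess_kato_L3_local` (Thm. 7.4),
  `galdi_energy_equality`, `ladyzhenskaya_prodi_serrin` (Thm. 1.2), the suitability of
  `L_{3,∞}` pairs being the theorem `NS.ess_suitable_of_L3infty'_holds`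
  (`FluidPDE/NSSuitableESSProofs`).

## Mathlib search

No Navier–Stokes notions in Mathlib. Tree: `NS.serrin_weak_strong_uniqueness_holds`,
`NS.weak_strong_uniqueness_of_datum` (`FluidPDE/NSSerrinUniqueness`),
`Fluid.eq_of_tendsto_nhdsGT_of_ae_eq`, `Fluid.IsLerayHopfOn.aestronglyMeasurable_datum_or`
(`FluidPDE/LerayHopfProofs`), `NS.ae_slice_eq_zero_of_datum_zero` (`FluidPDE/NSLerayHopfProofs`).

## References

* L. Escauriaza, G. Seregin, V. Šverák, *`L_{3,∞}`-solutions of Navier–Stokes equations and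
  backward uniqueness*, Russ. Math. Surveys 58:2 (2003), Thm. 1.3 and §3.
* J. Serrin, *The initial value problem for the Navier–Stokes equations*, 1963, Thm. 6.
* G. P. Galdi, *On the energy equality for distributional solutions to Navier–Stokes
  equations*, Proc. AMS 147 (2019), Thm. 1.1.
-/

noncomputable section

open MeasureTheory TopologicalSpace Set Function Filter Topology
open scoped InnerProductSpace RealInnerProductSpace ENNReal NNReal

namespace Literature.Analysis.FluidPDE

variable {E : Type*} [NormedAddCommGroup E] [InnerProductSpace ℝ E] [FiniteDimensional ℝ E]
  [MeasurableSpace E] [BorelSpace E]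
variable {T ν : ℝ} {f u : ℝ → E → E} {u₀ : E → E}

/-- **A Leray–Hopf solution which vanishes at a.e. time has a datum of zero energy**, whatever
the function `u₀` is: along the a.e. times `t` with `u(t) = 0` a.e., `‖u(t) - u₀‖₂ = ‖u₀‖₂`
(a lower Lebesgue integral, no measurability needed), and these times accumulate at `0⁺`, where
`‖u(t) - u₀‖₂ → 0` (`strong_initial`); so `‖u₀‖₂ = 0` and `E(u₀) = ½ ∫ ‖u₀‖² = 0` (the Bochner
integral of the then a.e.-vanishing, or else non-integrable, function `‖u₀‖²`). [folklore] -/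
theorem IsLerayHopfOn.kineticEnergy_datum_eq_zero (h : IsLerayHopfOn T ν f u₀ u) (hT : 0 < T)
    (h0 : ∀ᵐ t ∂(volume.restrict (Ioo 0 T)), u t =ᵐ[volume] 0) : VectorCalculus.kineticEnergy u₀ = 0 := by
  have hae : ∀ᵐ t ∂(volume.restrict (Ioo 0 T)),
      eLpNorm (u t - u₀) 2 volume = eLpNorm u₀ 2 volume := by
    filter_upwards [h0] with t ht
    have h' : (u t - u₀) =ᵐ[volume] fun x => -u₀ x := by
      filter_upwards [ht] with x hx
      simp [hx]
    rw [eLpNorm_congr_ae h', show (fun x => -u₀ x) = -u₀ from rfl, eLpNorm_neg]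
  have h2 : (0 : ℝ≥0∞) = eLpNorm u₀ 2 volume :=
    eq_of_tendsto_nhdsGT_of_ae_eq hT h.strong_initial hae
  have hlin : ∫⁻ x, ‖u₀ x‖ₑ ^ (2 : ℝ) = 0 := by
    have h3 : (∫⁻ x, ‖u₀ x‖ₑ ^ (2 : ℝ)) ^ (1 / (2 : ℝ)) = 0 := by
      have := h2.symm
      rwa [eLpNorm_eq_lintegral_rpow_enorm_toReal two_ne_zero ENNReal.ofNat_ne_top,
        ENNReal.toReal_ofNat] at this
    rcases ENNReal.rpow_eq_zero_iff.1 h3 with ⟨h4, -⟩ | ⟨-, h4⟩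
    · exact h4
    · norm_num at h4
  rw [VectorCalculus.kineticEnergy]
  by_cases hi : Integrable (fun x => ‖u₀ x‖ ^ 2) volume
  · have hint : ∫ x, ‖u₀ x‖ ^ 2 = 0 := by
      rw [integral_eq_lintegral_of_nonneg_ae (Eventually.of_forall fun _ => sq_nonneg _) hi.1]
      have hcongr : ∫⁻ x, ENNReal.ofReal (‖u₀ x‖ ^ 2) = ∫⁻ x, ‖u₀ x‖ₑ ^ (2 : ℝ) := by
        refine lintegral_congr fun x => ?_
        rw [ENNReal.ofReal_pow (norm_nonneg _), ofReal_norm,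
          show (2 : ℝ) = ((2 : ℕ) : ℝ) by norm_num, ENNReal.rpow_natCast]
      rw [hcongr, hlin, ENNReal.toReal_zero]
    rw [hint, mul_zero]
  · rw [integral_undef hi, mul_zero]

/-- **Zero datum energy kills a Leray–Hopf solution of the unforced system**: the energy
inequality from `0` gives `½‖u(t)‖₂² + ν ∫₀ᵗ ‖∇u‖₂² ≤ E(u₀) = 0` for every `t ∈ [0, T]`, so
`u(t) = 0` a.e. (`u(t) ∈ L²` by the `memLp` clause). [folklore] -/
theorem IsLerayHopfOn.ae_eq_zero_of_kineticEnergy_datum (h : IsLerayHopfOn T ν 0 u₀ u)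
    (hν : 0 ≤ ν) (hK : VectorCalculus.kineticEnergy u₀ = 0) : ∀ t ∈ Icc 0 T, u t =ᵐ[volume] 0 := by
  intro t htI
  obtain ⟨G, -, -, hE, -⟩ := h.weakGrad_energy
  have hle : VectorCalculus.kineticEnergy (u t) +
      ν * (∫⁻ τ in Ioo 0 t, ∫⁻ x, ENNReal.ofReal (frobeniusNormSq (G τ x))).toReal ≤ 0 := by
    simpa [hK] using hE t htI
  have hut : MemLp (u t) 2 volume := h.memLp t htI
  have hnn : 0 ≤ ν * (∫⁻ τ in Ioo 0 t, ∫⁻ x,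
      ENNReal.ofReal (frobeniusNormSq (G τ x))).toReal := mul_nonneg hν ENNReal.toReal_nonneg
  have hE0 : VectorCalculus.kineticEnergy (u t) = 0 :=
    le_antisymm (by linarith [kineticEnergy_nonneg (u t)]) (kineticEnergy_nonneg _)
  have hint : ∫ x, ‖u t x‖ ^ 2 = 0 := by
    have := hE0
    rw [VectorCalculus.kineticEnergy] at this
    simpa using this
  have hsq : (fun x => ‖u t x‖ ^ 2) =ᵐ[volume] 0 :=
    (integral_eq_zero_iff_of_nonneg (fun x => sq_nonneg _)
      ((memLp_two_iff_integrable_sq_norm hut.1).1 hut)).1 hint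
  filter_upwards [hsq] with x hx
  simpa using hx

end Literature.Analysis.FluidPDE

namespace Literature.Analysis.FluidPDE

open VectorCalculus

variable {ν T : ℝ} {u₀ : EuclideanSpace ℝ (Fin 3) → EuclideanSpace ℝ (Fin 3)}
  {u : ℝ → EuclideanSpace ℝ (Fin 3) → EuclideanSpace ℝ (Fin 3)}

/-- **Uniqueness among Leray–Hopf solutions for `u ∈ L^∞_t L³_x ∩ L⁵_t L⁵_x`** (ESS 2003, §3,
end of the proof of Thm. 1.3: "(1.14) and hence it is smooth and unique in `Q_T`"; Remark 7.5),
for every datum `u₀ : ℝ³ → ℝ³` of the accepted `Fluid.IsLerayHopfOn`. Honest branch (`u₀` a.e.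
strongly measurable, hence in `L²` by `Fluid.IsLerayHopfOn.memLp_two_datum`): the weak–strong
uniqueness theorem in the Serrin class `q = r = 5` (`serrin_weak_strong_uniqueness_holds`;
Serrin 1963, Thm. 6). Degenerate branch (all pairings `∫ ⟪u₀, w⟫` vanish): `u ≡ 0` slice-wise
a.e. (`ae_slice_eq_zero_of_datum_zero`, Galdi's energy equality), so `E(u₀) = 0`
(`Fluid.IsLerayHopfOn.kineticEnergy_datum_eq_zero`) and both `u` and `v` vanish on `[0, T]`
(`Fluid.IsLerayHopfOn.ae_eq_zero_of_kineticEnergy_datum`). Real proof. [cite: EscauriazaSereginSverak2003, §3, proof of Thm. 1.3] -/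
theorem ess_unique_of_memLqLp_five (hG : galdi_energy_equality) (hν : 0 < ν) (hT : 0 < T)
    (hu : FluidPDE.IsLerayHopfOn T ν 0 u₀ u) (h₃ : FluidPDE.MemLqLp ∞ 3 u (Ioo 0 T))
    (h5 : FluidPDE.MemLqLp 5 5 u (Ioo 0 T))
    {v : ℝ → EuclideanSpace ℝ (Fin 3) → EuclideanSpace ℝ (Fin 3)}
    (hv : FluidPDE.IsLerayHopfOn T ν 0 u₀ v) : ∀ t ∈ Ioc 0 T, v t =ᵐ[volume] u t := by
  rcases hu.aestronglyMeasurable_datum_or hT with hm | h0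
  · exact serrin_weak_strong_uniqueness_holds hν hT hu (hu.memLp_two_datum hT hm)
      three_lt_five_ennreal serrin_pair_five h5 hv
  · have hz := ae_slice_eq_zero_of_datum_zero hG hν hT hu h₃ h0
    have hK : VectorCalculus.kineticEnergy u₀ = 0 := hu.kineticEnergy_datum_eq_zero hT hz
    intro t ht
    have htI : t ∈ Icc 0 T := ⟨ht.1.le, ht.2⟩
    exact (hv.ae_eq_zero_of_kineticEnergy_datum hν.le hK t htI).trans
      (hu.ae_eq_zero_of_kineticEnergy_datum hν.le hK t htI).symm

/-- **Assembly of `NS.ess_endpoint` from (1.14), LPS and Galdi's energy equality** (ESS 2003,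
§3, end of the proof of Thm. 1.3, via Thm. 1.2 = Ladyzhenskaya–Prodi–Serrin with `s = l = 5`):
as the accepted `ess_endpoint_of_L5`, with the uniqueness half supplied by
`ess_unique_of_memLqLp_five` instead of the all-data fact `weak_strong_uniqueness`.
Real proof. [cite: EscauriazaSereginSverak2003, §3, proof of Thm. 1.3] -/
theorem ess_endpoint_of_L5_of_galdi (hL5 : ess_L5_integrability)
    (hLPS : ladyzhenskaya_prodi_serrin) (hG : galdi_energy_equality) : ess_endpoint := by
  intro ν T hν hT u₀ u hu h₃
  have h5 : FluidPDE.MemLqLp 5 5 u (Ioo 0 T) := hL5 hν hT hu h₃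
  refine ⟨?_, fun v hv => ess_unique_of_memLqLp_five hG hν hT hu h₃ h5 hv⟩
  obtain ⟨v, p, hcl, hae⟩ := hLPS hν hT hu three_lt_five_ennreal serrin_pair_five h5
  exact ⟨v, p, hcl.mono Ioo_subset_Ioc_self (uniqueDiffOn_Ioo 0 T),
    fun t ht => hae t (Ioo_subset_Ioc_self ht)⟩

/-- **`L₅` near `t = 0`, from Kato's theorem and the proved weak–strong uniqueness** (ESS 2003,
§3, end of the proof of Thm. 1.3: "since `a ∈ L₃ ∩ J̊` … we apply Theorem 7.4 and conclude that
`v ∈ L₅(Q_{δ₀})` for some `δ₀ > 0`"): as the accepted `exists_memLqLp_five_initial`, the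
identification of `u` with Kato's solution on `(0, min T T₁]` now by
`weak_strong_uniqueness_of_datum` (the datum is a.e. strongly measurable in that branch).
Real proof. [cite: EscauriazaSereginSverak2003, §3, proof of Thm. 1.3] -/
theorem exists_memLqLp_five_initial_of_kato (hK : ess_kato_L3_local)
    (hG : galdi_energy_equality) (hν : 0 < ν) (hT : 0 < T)
    (hu : FluidPDE.IsLerayHopfOn T ν 0 u₀ u) (h₃ : FluidPDE.MemLqLp ∞ 3 u (Ioo 0 T)) :
    ∃ δ₀ ∈ Ioc 0 T, FluidPDE.MemLqLp 5 5 u (Ioo 0 δ₀) := by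
  rcases hu.aestronglyMeasurable_datum_or hT with hm | h0
  · have hu₀2 : MemLp u₀ 2 volume := hu.memLp_two_datum hT hm
    have hu₀3 : MemLp u₀ 3 volume := hu.memLp_three_datum hT hm h₃
    have hdiv : FluidPDE.IsWeaklyDivFree u₀ := hu.isWeaklyDivFree_datum hT
    obtain ⟨T₁, hT₁, U, hU, -, hU5, -⟩ := hK hν hu₀2 hu₀3 hdiv
    have hT₂pos : 0 < min T T₁ := lt_min hT hT₁
    have hu' : FluidPDE.IsLerayHopfOn (min T T₁) ν 0 u₀ u := hu.of_le (min_le_left _ _)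
    have hU' : FluidPDE.IsLerayHopfOn (min T T₁) ν 0 u₀ U := hU.of_le (min_le_right _ _)
    have hU5' : FluidPDE.MemLqLp 5 5 U (Ioo 0 (min T T₁)) :=
      hU5.mono_set (Ioo_subset_Ioo_right (min_le_right _ _))
    have hae := weak_strong_uniqueness_of_datum hν hT₂pos hU' (Or.inl hm) three_lt_five_ennreal
      serrin_pair_five hU5' hu'
    refine ⟨min T T₁, ⟨hT₂pos, min_le_left _ _⟩, hU5'.congr_ae_slice ?_⟩
    exact (ae_restrict_iff' measurableSet_Ioo).2 (Eventually.of_forall fun t ht =>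
      hae t (Ioo_subset_Ioc_self ht))
  · exact ⟨T, ⟨hT, le_rfl⟩, FluidPDE.memLqLp_of_ae_slice_eq_zero
      (ae_slice_eq_zero_of_datum_zero hG hν hT hu h₃ h0)⟩

/-- **ESS Theorem 1.3, (1.14), from `ess_sup_bound`, Kato's theorem and Galdi's energy
equality** (ESS 2003, §3, proof of Thm. 1.3): as the accepted `ess_L5_integrability_of`, without
the all-data fact `weak_strong_uniqueness`. Real proof. [cite: EscauriazaSereginSverak2003, §3, proof of Thm. 1.3] -/
theorem ess_L5_integrability_of_sup_bound (h36 : ess_sup_bound) (hK : ess_kato_L3_local)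
    (hG : galdi_energy_equality) : ess_L5_integrability := by
  intro ν T hν hT u₀ u hu h₃
  rcases hu.aestronglyMeasurable_datum_or hT with hm | h0
  · have hu₀2 : MemLp u₀ 2 volume := hu.memLp_two_datum hT hm
    have hdiv : FluidPDE.IsWeaklyDivFree u₀ := hu.isWeaklyDivFree_datum hT
    obtain ⟨δ₀, hδ₀, h5⟩ := exists_memLqLp_five_initial_of_kato hK hG hν hT hu h₃
    have hδ : δ₀ / 2 ∈ Ioo 0 T := ⟨by linarith [hδ₀.1], by linarith [hδ₀.2]⟩
    have h5' := memLqLp_five_interior_of_ess_sup_bound h36 hν hT hu₀2 hdiv hu h₃ hδ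
    refine (h5.union h5').mono_set fun t ht => ?_
    by_cases hlt : t < δ₀
    · exact Or.inl ⟨ht.1, hlt⟩
    · exact Or.inr ⟨by linarith [hδ₀.1, not_lt.1 hlt], ht.2⟩
  · exact FluidPDE.memLqLp_of_ae_slice_eq_zero (ae_slice_eq_zero_of_datum_zero hG hν hT hu h₃ h0)

/-- **`NS.ess_endpoint` from the second-layer facts, without `weak_strong_uniqueness`** (ESS
2003, Thm. 1.3 with §3): `ess_sup_bound` ((3.5)–(3.6)), `ess_kato_L3_local` (Thm. 7.4),
`galdi_energy_equality` and `ladyzhenskaya_prodi_serrin` (Thm. 1.2) imply **ns.S08**.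
Real proof. [cite: EscauriazaSereginSverak2003, Thm. 1.3] -/
theorem ess_endpoint_of_sup_bound_of_kato (h36 : ess_sup_bound) (hK : ess_kato_L3_local)
    (hG : galdi_energy_equality) (hLPS : ladyzhenskaya_prodi_serrin) : ess_endpoint :=
  ess_endpoint_of_L5_of_galdi (ess_L5_integrability_of_sup_bound h36 hK hG) hLPS hG

/-- **`NS.ess_endpoint` from the Escauriaza–Seregin–Šverák theory: six named facts** (ESS 2003,
Thm. 1.3 with §§2–3 and the Appendix). The endpoint criterion **ns.S08** follows from ESS
Thm. 1.4 (`ess_local_holder`), Lemma 2.2 over the corrected Def. 2.1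
(`ess_epsilon_regularity'`), the associated pressure ((3.2)–(3.4), `ess_associated_pressure`),
Kato's `L³` theory (Thm. 7.4, `ess_kato_L3_local`), the energy equality for `L⁴(Q_T)` very weak
solutions (`galdi_energy_equality`) and the Ladyzhenskaya–Prodi–Serrin theorem (Thm. 1.2,
`ladyzhenskaya_prodi_serrin`); the suitability of `L_{3,∞}` pairs (proof of Thm. 1.4, first
paragraph) is the theorem `ess_suitable_of_L3infty'_holds` and weak–strong uniqueness the theorem
`serrin_weak_strong_uniqueness_holds`. Real proof. [cite: EscauriazaSereginSverak2003, Thm. 1.3] -/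
theorem ess_endpoint_of_ESS_theory (hLH : ess_local_holder) (hε : ess_epsilon_regularity')
    (hP : ess_associated_pressure) (hK : ess_kato_L3_local) (hG : galdi_energy_equality)
    (hLPS : ladyzhenskaya_prodi_serrin) : ess_endpoint :=
  ess_endpoint_of_sup_bound_of_kato (ess_sup_bound_of' hLH hε ess_suitable_of_L3infty'_holds hP)
    hK hG hLPS

end Literature.Analysis.FluidPDE
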